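import Mathlib
import Literature.Analysis.FluidPDE.TypeIAncientMild
import Literature.Analysis.FluidPDE.SelfSimilar
import Summits.NavierStokesRegularity.NavierStokesRegularity.Theses.SymmetryModuliCount
import Summits.NavierStokesRegularity.NavierStokesRegularity.Theorems.ScenarioCensusScrewBlowdownVanishing
import Summits.NavierStokesRegularity.NavierStokesRegularity.Theorems.DssFarFieldSlavingBlowupTypeIDssProfileSimilarityEnstrophyTimeOnlyThreshold
import HarnessLib

/-!
# Census block A2 (amplitude meters), cells A2arD (master) / A2arB / A2arS / A2arT / A2arL / A2arF / A2arR / A2arK (DECIDED), A2arP (OPEN) — instrument «LOUDNESS METER» (where, in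
# similarity variables, a class element stays `ε`-loud), LINE «loudness-meter» port, part 1/2: §A the instrument (`simAmp`, `EvQuiet`, `RecLoud`), §B the master law (blow-down +
# A2a gap + S3: `blowdown_quiet`, `eq_zero_of_quiet_dense`, `loud_ball_of_ne_zero`)

Re-homed for the scenario census (typer seat ns-census-typer-1 g9; the cells A2arD / A2arB / A2arS / A2arT / A2arL / A2arF / A2arR / A2arK are members of block A2
«DECIDED IN KERNEL IN FILES» (ref ns-census-ref g12 PRE-CHECK ✓ §17.14; critic PASS; lead label); this port makes them TREE-decided): VERBATIM PORT of ns-idea-2 LINE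
g16-2 «loudness-meter», `pub/ideators/ns-idea-2/lines/loudness-meter/line-loudness-meter.lean` sha16 913bd0567793a8c3 (471 l., lean check rc 0, 0 sorry), split for
the 400-line rule into `ScenarioCensusLoudnessMeter` (§A–§B) → `…LoudnessMeterRows` (§C + census KEYS).  Lean text VERBATIM in namespace
`…Theorems.ScenarioCensus.LoudnessMeter` (the line's `…Lines.LoudnessMeter` re-homed); port edits: `local notation "E3"` → `abbrev E3` (typer lint: no notation in port
files), `set_option linter.unusedVariables false` dropped (ref §17.14: a port must drop it), the `variable {C} {u}` line repeated at the head of part 2, `@[conjecture]`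
on the OPEN residual row `Row_A2arP` (typed only), ten one-line docstrings added and seven unused binder names `_`-prefixed (gate lint: 0 warnings; proof text only).  Statements untouched.

No census VALUE is moved here (the cells become TREE-decided by name; booking is the lead's); NS regularity is NOT proved; (L′) ⟨10661⟩ is untouched; no
summit statement is proved by this file.
-/

-- the summit and its single problem share the name `NavierStokesRegularity` (D-0017 nested layout)
set_option linter.dupNamespace false

noncomputable section

open Set Function Filter Metric
open scoped Topology
open Literature.Analysis.FluidPDE
open Summit.NavierStokesRegularity.NavierStokesRegularity.Theorems
open Summit.NavierStokesRegularity.NavierStokesRegularity.Theorems.SimilarityEnstrophy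

namespace Summit.NavierStokesRegularity.NavierStokesRegularity.Theorems.ScenarioCensus.LoudnessMeter

/-- `ℝ³` (the line's `local notation "E3"`, spelled as a reducible abbreviation for the tree). -/
abbrev E3 := EuclideanSpace ℝ (Fin 3)

variable {C : ℝ} {u : ℝ → E3 → E3}

/-! ## A. The instrument -/

/-- The SIMILARITY AMPLITUDE of `u` at time `s` and similarity position `η`: `√(−s)·‖u(s, √(−s) η)‖`. -/
def simAmp (u : ℝ → E3 → E3) (s : ℝ) (η : E3) : ℝ := Real.sqrt (-s) * ‖u s (Real.sqrt (-s) • η)‖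

/-- `u` is EVENTUALLY `ε`-QUIET at the similarity position `η` (towards the far past `s → −∞`). -/
def EvQuiet (ε : ℝ) (u : ℝ → E3 → E3) (η : E3) : Prop :=
  ∃ T : ℝ, T < 0 ∧ ∀ s : ℝ, s < T → simAmp u s η ≤ ε

/-- `u` is RECURRENTLY `ε`-LOUD at the similarity position `η`: before every time there is an earlier time
at which the similarity amplitude exceeds `ε`. -/
def RecLoud (ε : ℝ) (u : ℝ → E3 → E3) (η : E3) : Prop :=
  ∀ T : ℝ, T < 0 → ∃ s : ℝ, s < T ∧ ε < simAmp u s η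

/-- The similarity amplitude is non-negative. -/
theorem simAmp_nonneg (u : ℝ → E3 → E3) (s : ℝ) (η : E3) : 0 ≤ simAmp u s η :=
  mul_nonneg (Real.sqrt_nonneg _) (norm_nonneg _)

/-- Calibration: on the class the meter reads in `[0, C]`. -/
theorem simAmp_le (hu : IsTypeIAncientMild C u) {s : ℝ} (hs : s < 0) (η : E3) : simAmp u s η ≤ C := by
  have hsr : 0 < Real.sqrt (-s) := Real.sqrt_pos.2 (by linarith)
  have h := hu.norm_le hs (Real.sqrt (-s) • η)
  rw [le_div_iff₀ hsr] at h
  simpa [simAmp, mul_comm] using h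

/-- Quiet and loud are complementary readings. -/
theorem not_recLoud_iff {ε : ℝ} {η : E3} : ¬ RecLoud ε u η ↔ EvQuiet ε u η := by
  simp only [RecLoud, EvQuiet, not_forall, not_exists, not_and, not_lt, exists_prop]

/-- Not eventually quiet iff recurrently loud. -/
theorem not_evQuiet_iff {ε : ℝ} {η : E3} : ¬ EvQuiet ε u η ↔ RecLoud ε u η := by
  rw [← not_recLoud_iff, not_not]

/-- THE METER READS BLOW-DOWNS: `√(−t)·‖(μ-zoom of u)(t, x)‖` is the similarity amplitude of `u` at the
earlier time `μ² t` and the FIXED position `x/√(−t)`. -/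
theorem sqrt_mul_norm_nsRescale {μ t : ℝ} (hμ : 0 < μ) (ht : t < 0) (x : E3) :
    Real.sqrt (-t) * ‖nsRescale μ u t x‖ = simAmp u (μ ^ 2 * t) ((Real.sqrt (-t))⁻¹ • x) := by
  have hst : 0 < Real.sqrt (-t) := Real.sqrt_pos.2 (by linarith)
  have hsq : Real.sqrt (-(μ ^ 2 * t)) = μ * Real.sqrt (-t) := by
    rw [show -(μ ^ 2 * t) = μ ^ 2 * (-t) by ring, Real.sqrt_mul (sq_nonneg _), Real.sqrt_sq hμ.le]
  have hpt : (μ * Real.sqrt (-t)) • ((Real.sqrt (-t))⁻¹ • x) = μ • x := by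
    rw [smul_smul, mul_assoc, mul_inv_cancel₀ hst.ne', mul_one]
  simp only [simAmp, nsRescale, hsq, hpt, norm_smul, Real.norm_eq_abs, abs_of_pos hμ]
  ring

/-- Far out along a parabola: `R ≤ √(−s)·a` for all sufficiently negative `s` (`a > 0`). -/
theorem exists_far {a : ℝ} (ha : 0 < a) (R : ℝ) :
    ∃ T₁ : ℝ, T₁ < 0 ∧ ∀ s : ℝ, s < T₁ → R ≤ Real.sqrt (-s) * a := by
  have h0 : 0 ≤ (|R| / a) ^ 2 := sq_nonneg _
  refine ⟨-((|R| / a) ^ 2 + 1), by linarith, fun s hs => ?_⟩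
  have h1 : (|R| / a) ^ 2 < -s := by linarith
  have h2 : |R| / a < Real.sqrt (-s) := (Real.lt_sqrt (by positivity)).2 h1
  rw [div_lt_iff₀ ha] at h2
  exact (le_abs_self R).trans h2.le

/-! ## B. The master law -/

/-- Blow-down limits are quiet wherever a dense set of positions is eventually quiet. -/
theorem blowdown_quiet (_hu : IsTypeIAncientMild C u) {ε : ℝ} {D : Set E3} (hD : Dense D)
    (hq : ∀ η ∈ D, EvQuiet ε u η) {W : ℝ → E3 → E3}
    (hW : ScenarioCensus.ScrewBlowdown.IsBlowdownLimit C u W) :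
    ∀ t < 0, ∀ x, Real.sqrt (-t) * ‖W t x‖ ≤ ε := by
  obtain ⟨hWc, μ, hμ, hμlim, hconv⟩ := hW
  -- step 1: positions x/√(−t) ∈ D
  have step1 : ∀ t < 0, ∀ x : E3, (Real.sqrt (-t))⁻¹ • x ∈ D → Real.sqrt (-t) * ‖W t x‖ ≤ ε := by
    intro t ht x hxD
    have hL : Tendsto (fun k => nsRescale (μ k) u t x) atTop (𝓝 (W t x)) :=
      (hconv t ht).tendsto_comp (hWc.continuous_slice ht).continuousAt tendsto_const_nhds
    obtain ⟨T, hT, hTq⟩ := hq _ hxD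
    have ht' : 0 < -t := by linarith
    have hev : ∀ᶠ k in atTop, μ k ^ 2 * t < T := by
      have : Tendsto (fun k => μ k ^ 2 * (-t)) atTop atTop :=
        (tendsto_pow_atTop two_ne_zero |>.comp hμlim).atTop_mul_const ht'
      exact (this.eventually_gt_atTop (-T)).mono fun k hk => by linarith
    have hevb : ∀ᶠ k in atTop, Real.sqrt (-t) * ‖nsRescale (μ k) u t x‖ ≤ ε := by
      filter_upwards [hev] with k hk
      rw [sqrt_mul_norm_nsRescale (hμ k) ht]
      exact hTq _ hk
    exact le_of_tendsto (hL.norm.const_mul _) hevb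
  -- step 2: density of `√(−t)·D` and continuity of the slice `W t`
  intro t ht x
  have hst : 0 < Real.sqrt (-t) := Real.sqrt_pos.2 (by linarith)
  have hclosed : IsClosed {y : E3 | Real.sqrt (-t) * ‖W t y‖ ≤ ε} :=
    isClosed_le (continuous_const.mul (hWc.continuous_slice ht).norm) continuous_const
  have hmem : (Real.sqrt (-t))⁻¹ • x ∈ closure D := by rw [hD.closure_eq]; exact mem_univ _
  obtain ⟨η, hηD, hηlim⟩ := mem_closure_iff_seq_limit.1 hmem
  have hylim : Tendsto (fun n => Real.sqrt (-t) • η n) atTop (𝓝 x) := by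
    have := hηlim.const_smul (Real.sqrt (-t))
    simpa [smul_smul, mul_inv_cancel₀ hst.ne'] using this
  refine hclosed.mem_of_tendsto hylim (Eventually.of_forall fun n => ?_)
  show Real.sqrt (-t) * ‖W t (Real.sqrt (-t) • η n)‖ ≤ ε
  refine step1 t ht _ ?_
  simpa [smul_smul, inv_mul_cancel₀ hst.ne'] using hηD n

/-- **MASTER LAW** (PROVED): if for some `ε < 1` the eventually-`ε`-quiet similarity positions of a Type-I
ancient mild field are DENSE, the field is identically zero.  (Blow-down limits are then quiet everywhere
(`blowdown_quiet`), hence zero by the time-constant gap A2a, hence `u ≡ 0` by the tree's S3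
`vanishingBlowdownLiouville_holds`.) -/
theorem eq_zero_of_quiet_dense (hu : IsTypeIAncientMild C u) {ε : ℝ} (hε : ε < 1) {D : Set E3}
    (hD : Dense D) (hq : ∀ η ∈ D, EvQuiet ε u η) : ∀ t < 0, ∀ x, u t x = 0 :=
  ScenarioCensus.ScrewBlowdown.vanishingBlowdownLiouville_holds C u hu fun _ hW =>
    typeI_ancient_eq_zero_of_timeConstant_lt_one_noDecay hε hW.1 (blowdown_quiet hu hD hq hW)

/-- **LOUD-BALL LAW** (PROVED; the N1 datum): a NONZERO Type-I ancient mild field is, for every `ε < 1`,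
recurrently `ε`-loud at every similarity position of some open ball — in its far past the scale-invariant
amplitude exceeds `ε/√(−s)` infinitely often along EVERY parabola `x = √(−s)η`, `η` in a solid ball. -/
theorem loud_ball_of_ne_zero (hu : IsTypeIAncientMild C u) (hne : ∃ t < 0, ∃ x, u t x ≠ 0) {ε : ℝ}
    (hε : ε < 1) : ∃ η₀ : E3, ∃ δ > 0, ∀ η : E3, dist η η₀ < δ → RecLoud ε u η := by
  by_contra h
  push Not at h
  have hD : Dense {η : E3 | EvQuiet ε u η} := by
    refine Metric.dense_iff.2 fun η₀ δ hδ => ?_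
    obtain ⟨η, hη, hnl⟩ := h η₀ δ hδ
    exact ⟨η, mem_ball.2 hη, not_recLoud_iff.1 hnl⟩
  obtain ⟨t, ht, x, hx⟩ := hne
  exact hx (eq_zero_of_quiet_dense hu hε hD (fun η hη => hη) t ht x)

/-- **END-QUIET** calibration (PROVED; the uniform special case, census A2a on a backward end): quiet
everywhere on a far-past end ⇒ zero. -/
theorem endQuiet_eq_zero (hu : IsTypeIAncientMild C u) {ε T : ℝ} (hε : ε < 1) (hT : T < 0)
    (hq : ∀ s < T, ∀ x, Real.sqrt (-s) * ‖u s x‖ ≤ ε) : ∀ t < 0, ∀ x, u t x = 0 :=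
  eq_zero_of_quiet_dense hu hε dense_univ fun _ _ => ⟨T, hT, fun s hs => hq s hs _⟩

end Summit.NavierStokesRegularity.NavierStokesRegularity.Theorems.ScenarioCensus.LoudnessMeter

end
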